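import Literature.MathematicalPhysics.QuantumFieldTheory.QCDSlabFunctional
import Literature.MathematicalPhysics.QuantumFieldTheory.LatticeGaugeProofs

/-!
# `SlabToTorus` (stmt-QuantumFields-10529), part 2: the circle lattice `ℤ_N × (ℤ/N)³` IS the torus `(ℤ/N)⁴`

Helper file for the route item `CentreStabilisedCircle.SlabToTorus`. The centre-stabilised circle
functional of `QCDSlabFunctional.lean` lives on `SlabGauge.Site 3 N N = ZMod N × (Fin 3 → ZMod N)`
(circle = `ℤ⁴`-coordinate `3`), the tree's torus functional `qcdTorusExpect` on
`TorusSite 4 N = Fin 4 → ZMod N`. The identification is carried by CLOSED Mathlib terms (no new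
definitions; abbreviated by local notation in this file only):

* sites: `sE = Fin.snocEquiv (fun _ => ZMod N) : ZMod N × (Fin 3 → ZMod N) ≃ (Fin 4 → ZMod N)`,
  `(t, x⃗) ↦ Fin.snoc x⃗ t`, whose inverse composed with `Torus.proj` is `circleSite`
  definitionally;
* links: `E = Equiv.prodCongr sE.symm (finSuccEquiv' 3)` (torus link ↦ circle link, axis `3 ↦ none`,
  `j.castSucc ↦ some j`);
* gauge fields: `Ψ = (MeasurableEquiv.piCongrLeft (fun _ => SU(3)) E).symm`, the measurable
  equivalence `QCDCircleConfig N N ≃ᵐ GaugeConfig 4 N SU(3)`, `(Ψ U) b = U (E b)`.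

Proved here: `Ψ` intertwines the periodic lifts (`torusLift_Ψ`), shifts (`sE_shift`) and
plaquettes (`plaquetteHolonomy_Ψ`); the torus Wilson density `exp(−β S_W(Ψ U))` is the constant
`exp(−3β #plaquettes)` times the circle weight `SlabGauge.weight ρ β β U` (`exp_neg_mul_wilsonAction_Ψ`:
the six plaquette planes of `ℤ⁴` are the three box planes plus the three (box, circle) planes, the
latter traversed in the opposite orientation, which does not change `Re tr` on `SU(3)`); and `Ψ`
carries the product Haar measure to the product Haar measure (`measurePreserving_Ψ`).
All statements are routine bookkeeping ("folklore").
-/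

namespace Summit.QuantumFields.QCD.Theorems.CentreStabilisedCircleSlabToTorus

open MeasureTheory
open Literature.MathematicalPhysics.QuantumLattice Literature.MathematicalPhysics.QuantumFieldTheory
open Literature.Probability.LatticeModels (TorusSite Torus.proj)

local notation "𝔾" => Matrix.specialUnitaryGroup (Fin 3) ℂ

/-- The site bijection `ℤ_N × (ℤ/N)³ ≃ (ℤ/N)⁴`, `(t, x⃗) ↦ Fin.snoc x⃗ t` (local notation). -/
local notation "sE[" N "]" => (Fin.snocEquiv fun _ : Fin 4 => ZMod N : SlabGauge.Site 3 N N ≃ TorusSite 4 N)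

/-- The link bijection torus → circle (local notation). -/
local notation "E[" N "]" =>
  (Equiv.prodCongr (Equiv.symm (Fin.snocEquiv fun _ : Fin 4 => ZMod N)) (finSuccEquiv' (3 : Fin 4)) :
    TorusSite 4 N × Fin 4 ≃ SlabGauge.Site 3 N N × SlabGauge.Dir 3)

/-- The gauge-field bijection circle → torus, `(Ψ U) b = U (E b)` (local notation). -/
local notation "Ψ[" N "]" =>
  (MeasurableEquiv.symm (MeasurableEquiv.piCongrLeft (fun _ : SlabGauge.Site 3 N N × SlabGauge.Dir 3 => 𝔾)
    (Equiv.prodCongr (Equiv.symm (Fin.snocEquiv fun _ : Fin 4 => ZMod N)) (finSuccEquiv' (3 : Fin 4)) :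
      TorusSite 4 N × Fin 4 ≃ SlabGauge.Site 3 N N × SlabGauge.Dir 3)))

variable {N : ℕ}

/-- `(Ψ U)` reads the torus link `b` at the circle link `E b`. [folklore] -/
theorem Ψ_apply (U : QCDCircleConfig N N) (b : TorusSite 4 N × Fin 4) :
    Ψ[N] U b = U (E[N] b) := rfl

/-- `E (sE x, axis of μ) = (x, μ)`. [folklore] -/
theorem E_apply_sE (x : SlabGauge.Site 3 N N) (μ : SlabGauge.Dir 3) :
    E[N] (sE[N] x, μ.elim 3 Fin.castSucc) = (x, μ) := by
  rw [Equiv.prodCongr_apply, Prod.map_apply, Equiv.symm_apply_apply, finSuccEquiv'_three_elim]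

/-- `(Ψ U)` at the torus link `(sE x, axis of μ)` is `U (x, μ)`. [folklore] -/
theorem Ψ_apply_sE (U : QCDCircleConfig N N) (x : SlabGauge.Site 3 N N) (μ : SlabGauge.Dir 3) :
    Ψ[N] U (sE[N] x, μ.elim 3 Fin.castSucc) = U (x, μ) := by
  rw [Ψ_apply, E_apply_sE]

/-- `sE⁻¹ ∘ Torus.proj = circleSite` (definitionally). [folklore] -/
theorem sE_symm_proj (y : Fin 4 → ℤ) : (sE[N]).symm (Torus.proj N y) = circleSite N N y := rfl

/-- **The periodic lifts agree**: `torusLift N (Ψ U) = circleGaugeLift N N U`. [folklore] -/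
theorem torusLift_Ψ (U : QCDCircleConfig N N) : torusLift N (Ψ[N] U) = circleGaugeLift N N U := rfl

/-- **`sE` intertwines the lattice shifts**: `sE (x + μ̂) = sE x + e_{axis μ}`. [folklore] -/
theorem sE_shift (x : SlabGauge.Site 3 N N) (μ : SlabGauge.Dir 3) :
    sE[N] (x.shift μ) = Site.shift (sE[N] x) (μ.elim 3 Fin.castSucc) := by
  have h3 : (3 : Fin 4) = Fin.last 3 := rfl
  funext i
  simp only [Fin.snocEquiv_apply, Site.shift, Pi.add_apply]
  cases μ with
  | none =>
      simp only [SlabGauge.Site.shift, Option.elim_none, h3]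
      refine Fin.lastCases ?_ (fun j => ?_) i
      · simp only [Fin.snoc_last, Pi.single_eq_same]
      · simp only [Fin.snoc_castSucc, Pi.single_eq_of_ne (Fin.castSucc_lt_last j).ne, add_zero]
  | some k =>
      simp only [SlabGauge.Site.shift, Option.elim_some]
      refine Fin.lastCases ?_ (fun j => ?_) i
      · simp only [Fin.snoc_last, Pi.single_eq_of_ne (Fin.castSucc_lt_last k).ne', add_zero]
      · simp only [Fin.snoc_castSucc, Pi.add_apply, Pi.single_apply, Fin.castSucc_inj]

/-- **Plaquettes of `Ψ U` are the plaquettes of `U`**: the torus plaquette holonomy of `Ψ U` at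
`sE x` in the plane of the axes of `μ, ν` is `SlabGauge.plaquette U x μ ν`. [folklore] -/
theorem plaquetteHolonomy_Ψ (U : QCDCircleConfig N N) (x : SlabGauge.Site 3 N N)
    (μ ν : SlabGauge.Dir 3) :
    plaquetteHolonomy (Ψ[N] U) (sE[N] x) (μ.elim 3 Fin.castSucc) (ν.elim 3 Fin.castSucc) =
      SlabGauge.plaquette U x μ ν := by
  simp only [plaquetteHolonomy, SlabGauge.plaquette, ← sE_shift, Ψ_apply_sE]

/-- Reversing the orientation of a plaquette inverts its holonomy. [folklore] -/
theorem plaquette_swap {G : Type*} [Group G] {d L₀ L : ℕ} (U : SlabGauge.Config d L₀ L G)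
    (x : SlabGauge.Site d L₀ L) (μ ν : SlabGauge.Dir d) :
    SlabGauge.plaquette U x μ ν = (SlabGauge.plaquette U x ν μ)⁻¹ := by
  simp only [SlabGauge.plaquette, mul_inv_rev, inv_inv, mul_assoc]

/-- `Re tr P⁻¹ = Re tr P` on `SU(3)` (`P⁻¹ = P†`). [folklore] -/
theorem re_trace_fundamentalRep_inv (P : 𝔾) :
    (fundamentalRep (Fin 3) P⁻¹).trace.re = (fundamentalRep (Fin 3) P).trace.re := by
  rw [fundamentalRep_apply, fundamentalRep_apply, ← Matrix.star_eq_inv,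
    Matrix.specialUnitaryGroup.coe_star, Matrix.star_eq_conjTranspose, Matrix.trace_conjTranspose,
    Complex.star_def, Complex.conj_re]

variable [NeZero N]

/-- The six coordinate planes `i < j` of `Fin 4`: three with `j = 3` and the three planes of `Fin 3`. [folklore] -/
theorem sum_ltPairs_fin_four {M : Type*} [AddCommMonoid M] (g : Fin 4 → Fin 4 → M) :
    ∑ q : {q : Fin 4 × Fin 4 // q.1 < q.2}, g q.1.1 q.1.2 =
      ∑ i : Fin 3, g i.castSucc 3 +
        ∑ q : {q : Fin 3 × Fin 3 // q.1 < q.2}, g q.1.1.castSucc q.1.2.castSucc := by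
  have h4 : ∑ q : {q : Fin 4 × Fin 4 // q.1 < q.2}, g q.1.1 q.1.2 =
      ∑ q ∈ (Finset.univ : Finset (Fin 4 × Fin 4)).filter (fun q => q.1 < q.2), g q.1 q.2 :=
    (Finset.sum_subtype _ (fun q => by simp) (fun q : Fin 4 × Fin 4 => g q.1 q.2)).symm
  have h3 : ∑ q : {q : Fin 3 × Fin 3 // q.1 < q.2}, g q.1.1.castSucc q.1.2.castSucc =
      ∑ q ∈ (Finset.univ : Finset (Fin 3 × Fin 3)).filter (fun q => q.1 < q.2),
        g q.1.castSucc q.2.castSucc :=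
    (Finset.sum_subtype _ (fun q => by simp) (fun q : Fin 3 × Fin 3 => g q.1.castSucc q.2.castSucc)).symm
  have hc2 : (Fin.castSucc (2 : Fin 3) : Fin 4) = 2 := rfl
  rw [h4, h3, Finset.sum_filter, Finset.sum_filter, Fintype.sum_prod_type, Fintype.sum_prod_type]
  simp only [Fin.sum_univ_four, Fin.sum_univ_three, Fin.isValue, Fin.castSucc_zero, Fin.castSucc_one,
    hc2]
  simp only [Fin.isValue, lt_self_iff_false, ↓reduceIte, zero_add, add_zero,
    show (0 : Fin 4) < 1 from by decide, show (0 : Fin 4) < 2 from by decide,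
    show (0 : Fin 4) < 3 from by decide, show (1 : Fin 4) < 2 from by decide,
    show (1 : Fin 4) < 3 from by decide, show (2 : Fin 4) < 3 from by decide,
    show ¬ (1 : Fin 4) < 0 from by decide, show ¬ (2 : Fin 4) < 0 from by decide,
    show ¬ (3 : Fin 4) < 0 from by decide, show ¬ (2 : Fin 4) < 1 from by decide,
    show ¬ (3 : Fin 4) < 1 from by decide, show ¬ (3 : Fin 4) < 2 from by decide,
    show (0 : Fin 3) < 1 from by decide, show (0 : Fin 3) < 2 from by decide,
    show (1 : Fin 3) < 2 from by decide, show ¬ (1 : Fin 3) < 0 from by decide,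
    show ¬ (2 : Fin 3) < 0 from by decide, show ¬ (2 : Fin 3) < 1 from by decide]
  abel

/-- **The torus Wilson action of `Ψ U` in terms of the circle plaquettes**:
`S_W(Ψ U) = 3·#plaquettes − (Σ_{x,i} Re tr U_{x; ∘ i} + Σ_{x, i<j} Re tr U_{x; i j})`. [folklore] -/
theorem wilsonAction_Ψ (U : QCDCircleConfig N N) :
    wilsonAction (fundamentalRep (Fin 3)) (Ψ[N] U) =
      3 * Fintype.card (Plaquette 4 N) -
        (∑ x : SlabGauge.Site 3 N N, ∑ i : Fin 3,
            (fundamentalRep (Fin 3) (SlabGauge.plaquette U x none (some i))).trace.re +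
          ∑ x : SlabGauge.Site 3 N N, ∑ p : {p : Fin 3 × Fin 3 // p.1 < p.2},
            (fundamentalRep (Fin 3) (SlabGauge.plaquette U x (some p.1.1) (some p.1.2))).trace.re) := by
  unfold wilsonAction
  rw [Finset.sum_sub_distrib, Finset.sum_const, Finset.card_univ, nsmul_eq_mul, Nat.cast_ofNat,
    mul_comm]
  congr 1
  rw [Fintype.sum_prod_type, ← Finset.sum_add_distrib, ← (sE[N]).sum_comp]
  refine Finset.sum_congr rfl fun x _ => ?_
  dsimp only
  refine (sum_ltPairs_fin_four (fun i j =>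
    (fundamentalRep (Fin 3) (plaquetteHolonomy (Ψ[N] U) (sE[N] x) i j)).trace.re)).trans ?_
  refine congrArg₂ (· + ·) ?_ ?_
  · refine Finset.sum_congr rfl fun i _ => ?_
    have h := plaquetteHolonomy_Ψ U x (some i) none
    simp only [Option.elim_some, Option.elim_none] at h
    rw [h, plaquette_swap, re_trace_fundamentalRep_inv]
  · refine Finset.sum_congr rfl fun p _ => ?_
    have h := plaquetteHolonomy_Ψ U x (some p.1.1) (some p.1.2)
    simp only [Option.elim_some] at h
    rw [h]

/-- **The torus Wilson density is a constant multiple of the circle weight**: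
`exp(−β S_W(Ψ U)) = exp(−3β #plaquettes) · SlabGauge.weight ρ β β U`. [folklore] -/
theorem exp_neg_mul_wilsonAction_Ψ (β : ℝ) (U : QCDCircleConfig N N) :
    Real.exp (-β * wilsonAction (fundamentalRep (Fin 3)) (Ψ[N] U)) =
      Real.exp (-(β * (3 * Fintype.card (Plaquette 4 N)))) *
        SlabGauge.weight (fundamentalRep (Fin 3)) β β U := by
  rw [SlabGauge.weight, ← Real.exp_add, wilsonAction_Ψ, SlabGauge.minusAction]
  congr 1
  ring

/-- **`Ψ` carries the product Haar measure of the circle lattice to that of the torus.** [folklore] -/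
theorem measurePreserving_Ψ :
    MeasurePreserving (Ψ[N]) (SlabGauge.haar 3 N N 𝔾)
      (Measure.pi fun _ : Edge 4 N => haarProbability 𝔾) :=
  (measurePreserving_piCongrLeft (fun _ : SlabGauge.Site 3 N N × SlabGauge.Dir 3 => haarProbability 𝔾)
    (E[N])).symm _

end Summit.QuantumFields.QCD.Theorems.CentreStabilisedCircleSlabToTorus
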